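/-
Origin: expansion seat `planner-pub-hodgecm-pv07-g5-0`, handover #3 2026-08-18T12:57:19Z (md5 3185ada8f2984d0ce9f1c087fcac7fad; NEW additive leaf; ONE import rewrite Pv07g5.GenuineTransfer -> HodgeCM.PerL34.GenuineTransfer (my #1); land AFTER my #1; pv09-g7 GenuineCoeffMatch and my #4 import it) (`HOME/pub-hodgecm-pv07-g5/lean/Pv07g5/GenuineCoeffInput.lean`, md5 3185ada8, 475 lines);
landed by the gen-8 packager in gate run 30 as `HodgeCM/PerL34/GenuineCoeffInput.lean` (import ^import Pv07g5\.GenuineTransfer[ \t]*$→import HodgeCM.PerL34.GenuineTransfer ×1).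
-/
/-
Copyright: HodgeCM publication cell (pub-hodgecm), DAG node N31 (seam S3, PerL v5 Lemma 4.2(b)) — the torus-side
input of the S3 END at the level of MATRIX COEFFICIENTS (no isometries from local `L²` spaces), its functoriality in
BOTH directions along isometric equivariant maps, restriction to a stable submodule, and the END from it.
Prover seat pub-hodgecm-pv07-g5 (DAG-node prover #07, generation 5), file #3 (HANDOVER #3).  Released under the
package licence.

Imports this seat's file #1 (`GenuineTransfer`, HANDOVER #1; in the tree `HodgeCM.PerL34.GenuineTransfer`) and through
it the tree only.  Complete proofs, no new axioms, nothing cited, no hypothesis posited.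
-/
import Summits.HodgeConjecture.HodgeCM.PerL34.GenuineTransfer

/-!
# The torus side of Lemma 4.2(b) at coefficient level

pv09-g5's input structure `GenuineThetaInput L S Sp ω φ χ` packages the split-place data of tex ll. 600–616 as
ISOMETRIC INTERTWINERS `VU_v, VS_v : L²((L⁺_v)³) →ₗᵢ[ℂ] Sp` from the FULL local `L²` spaces.  The END consumes them
only through the two coefficient identities they produce (tree `NonsplitRamified.coeff_eq_of_intertwiner`,
`coeffS_of_intertwiner`: `⟪φ, ω(ι_v g) φ⟫ = c_v · ⟪ψ_v, ω^{dil}_{ν_v}(τ_v g) ψ_v⟫`), but as TYPED they force the space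
`Sp` of the doubling datum to contain isometric copies of local `L²` spaces — which the space of a genuine adelic
theta datum (Schwartz–Bruhat functions, on which the theta functional `Θ` of `ThetaSide` is defined and automorphic)
does not.

This file re-types the input at the level the END actually uses:

* §1 complements to file #1's transfer: PULL-BACK of fixed vectors / eigen-equations / the product formula along an
  isometric equivariant map (injectivity of an isometry), the coefficient power identity from a coefficient identity,
  and the RESTRICTION `Transfer.restrict ω V hV : Γ →* (V ≃ₗᵢ[ℂ] V)` of a unitary representation to a stable
  submodule `V` (the inclusion `V.subtypeₗᵢ` is then equivariant, by `rfl`), e.g. to the cyclic subspace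
  `Transfer.cyclicSpan ω φ` (finite combinations of translates; stable, contains `φ`);
* §2 `GenuineCoeffInput L S Sp ω φ χ`: `GenuineThetaInput` with the four intertwiner fields `VU, hVUψ, hVU` /
  `VS, hVSψ, hVS` (and the scalar `a`) REPLACED by the two coefficient identities `hcoeffU`, `hcoeffS` and the positive
  constants `c_v` (`= ‖a_v‖²`); `GenuineThetaInput.toCoeffInput` (needs `‖φ‖ = 1` for `0 < c_v`);
* §3 functoriality in both directions: `GenuineCoeffInput.map` (push forward along `E`, for `E φ`) and
  `GenuineCoeffInput.comap` (pull back along `E`, for `φ` from `E φ`) — matrix coefficients of `(ω, φ)` are invariants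
  of isometric equivariant maps either way, so the coefficient-level input lives on ANY equivariant isometric image of
  the cyclic space of `φ`, complete or not;
* §4 **the END from the coefficient-level input** `exists_compactDomain_thetaLift_ne_zero_genuine_of_coeffInput`
  (pv09-g4's `exists_compactDomain_thetaLift_ne_zero_of_model` fed exactly as in pv09-g5's
  `exists_compactDomain_thetaLift_ne_zero_genuine_base`, the two dictionary binders now read off the structure), and
  **the END along an embedding at coefficient level** `exists_compactDomain_thetaLift_ne_zero_genuine_of_coeffEmbedding`.

Upshot for the MODEL residual of seam S3 (LEMMAS §3 D4): a genuine datum `D` on a Schwartz-type space `Sp` meets the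
torus side of the S3 END as soon as `Sp` contains an isometric `Model L`-equivariant image of ANY stable subspace of a
torus model containing the model vector — e.g. the (algebraic) cyclic subspace of `φ_e` in pv07-g4's `L²(X)`, which
consists of finite combinations of twisted dilates of `φ_e` (file #4 of this seat states that case by name).

ABSOLUTE RULE respected: nothing cited; every hypothesis is data, a hypothesis of pv09-g4/g5's END passed through
unchanged, or an equivariance equation.
-/

set_option linter.unusedSectionVars false

noncomputable section

open MeasureTheory MeasureTheory.Measure Set Metric Function Complex ComplexConjugate Topology Filter
open scoped RestrictedProduct InnerProductSpace NNReal ENNReal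

namespace HodgeCM.PerL34.PureTensor

open HodgeCM.PerL34.SplitShells HodgeCM.PerL34.AdelicFactorisation HodgeCM.PerL34.RestrictedMeasure
open HodgeCM.PerL34.NoSmallSubgroups HodgeCM.PerL34.EulerFactorisation HodgeCM.PerL34.DiscreteFD
open HodgeCM.PerL34.LocalFactors HodgeCM.PerL34.LocalFactors.DilationModel
open HodgeCM.PerL34.LocalModulus HodgeCM.PerL34.SplitPlaceDilation
open HodgeCM.PerL34.RallisIP HodgeCM.PerL34.Doubling HodgeCM.PerL34.N31d NumberField IsDedekindDomain
open HodgeCM.PerL34.IdelePlaces HodgeCM.PerL34.RestrictedRegroup HodgeCM.PerL34.RestrictedCutout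
open HodgeCM.PerL34.IdelicTorusModel HodgeCM.PerL34.IdelicTorusModel.Genuine

attribute [local instance] LocalFactors.DilationModel.Adic.nontriviallyNormedField
  LocalFactors.DilationModel.Adic.properSpace

/-! ## §1  Complements to the transfer: pull-back, powers, restriction to a stable submodule -/

namespace Transfer

section group

variable {Γ : Type*} [Group Γ]
  {Sp₁ Sp₂ : Type*} [NormedAddCommGroup Sp₁] [InnerProductSpace ℂ Sp₁]
  [NormedAddCommGroup Sp₂] [InnerProductSpace ℂ Sp₂]
  (ω₁ : Γ →* (Sp₁ ≃ₗᵢ[ℂ] Sp₁)) (ω₂ : Γ →* (Sp₂ ≃ₗᵢ[ℂ] Sp₂))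
  (E : Sp₁ →ₗᵢ[ℂ] Sp₂) (hE : ∀ (g : Γ) (v : Sp₁), E (ω₁ g v) = ω₂ g (E v))

include hE

/-- fixed vectors pull back: `ω₂ k (E φ) = E φ ⟹ ω₁ k φ = φ` (an isometry is injective). -/
theorem fixed_of_map {φ : Sp₁} {k : Γ} (hk : ω₂ k (E φ) = E φ) : ω₁ k φ = φ :=
  E.injective (by rw [hE, hk])

/-- fixed vectors of a family pull back (the END's binder `hK`). -/
theorem fixed_of_mem_of_map {φ : Sp₁} {K : Set Γ} (hK : ∀ k ∈ K, ω₂ k (E φ) = E φ) :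
    ∀ k ∈ K, ω₁ k φ = φ :=
  fun k hk => fixed_of_map ω₁ ω₂ E hE (hK k hk)

/-- eigen-equations pull back: `ω₂ g (E φ) = c • E φ ⟹ ω₁ g φ = c • φ`. -/
theorem smul_eq_of_map {φ : Sp₁} {g : Γ} {c : ℂ} (h : ω₂ g (E φ) = c • E φ) : ω₁ g φ = c • φ :=
  E.injective (by rw [hE, h, LinearIsometry.map_smul])

end group

section restricted

universe u v

variable {ι : Type u} {G : ι → Type v} [∀ i, Group (G i)] [DecidableEq ι]
  {Sub : ι → Type*} [∀ i, SetLike (Sub i) (G i)] [∀ i, SubgroupClass (Sub i) (G i)]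
  (B : ∀ i, Sub i)
  {Sp₁ Sp₂ : Type*} [NormedAddCommGroup Sp₁] [InnerProductSpace ℂ Sp₁]
  [NormedAddCommGroup Sp₂] [InnerProductSpace ℂ Sp₂]
  (ω₁ : (Πʳ i, [G i, B i]) →* (Sp₁ ≃ₗᵢ[ℂ] Sp₁)) (ω₂ : (Πʳ i, [G i, B i]) →* (Sp₂ ≃ₗᵢ[ℂ] Sp₂))
  (E : Sp₁ →ₗᵢ[ℂ] Sp₂) (hE : ∀ (g : Πʳ i, [G i, B i]) (v : Sp₁), E (ω₁ g v) = ω₂ g (E v))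

include hE

/-- the pure-tensor product formula pulls back (the END's binder `hM`, from `E φ` to `φ`). -/
theorem prodFormula_of_map (φ : Sp₁) {T : Finset ι}
    (hM : ∀ S : Finset ι, T ⊆ S → ∀ y : (i : ↥S) → G i,
      ⟪E φ, ω₂ (extendOne B S y) (E φ)⟫_ℂ = ∏ i : ↥S, localCoeff B ω₂ (E φ) i (y i)) :
    ∀ S : Finset ι, T ⊆ S → ∀ y : (i : ↥S) → G i,
      ⟪φ, ω₁ (extendOne B S y) φ⟫_ℂ = ∏ i : ↥S, localCoeff B ω₁ φ i (y i) := by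
  intro S hS y
  rw [← inner_map_apply ω₁ ω₂ E hE, hM S hS y]
  exact Finset.prod_congr rfl fun i _ => localCoeff_map B ω₁ ω₂ E hE φ i (y i)

end restricted

section zpow

variable {ι : Type} {G : ι → Type} [∀ i, CommGroup (G i)] [DecidableEq ι]
  (B : ∀ i, Subgroup (G i))
  {Sp : Type} [NormedAddCommGroup Sp] [InnerProductSpace ℂ Sp]
  (ω : (Πʳ j, [G j, B j]) →* (Sp ≃ₗᵢ[ℂ] Sp)) (φ : Sp)
  {F : Type} [NormedField F] [IsUltrametricDist F] [ProperSpace F] {n : ℕ}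
  [MeasurableSpace (Fin n → F)] [BorelSpace (Fin n → F)] (μV : Measure (Fin n → F))
  [μV.IsAddHaarMeasure] (ν : Fˣ →* Circle)

/-- binder `coeff_eq` of pv09-g4's END (powers of the uniformizer) from a coefficient identity along a HOMOMORPHISM
`t` with `t ϖ = ϖF` (tree `coeff_zpow_of_intertwiner` with the intertwiner replaced by its coefficient identity). -/
theorem coeff_zpow_of_coeff_eq (i : ι) (t : G i →* Fˣ) (ϖ : G i) (ϖF : Fˣ) (ht : t ϖ = ϖF) (ψ : Lp ℂ 2 μV)
    (hc : ∀ g : G i, localCoeff B ω φ i g = ⟪ψ, dilationRep μV ν (t g) ψ⟫_ℂ) (m : ℤ) :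
    localCoeff B ω φ i (ϖ ^ m) = ⟪ψ, dilationRep μV ν (ϖF ^ m) ψ⟫_ℂ := by
  rw [hc, map_zpow, ht]

end zpow

/-! ### Restriction of a unitary representation to a stable submodule -/

section restrict

variable {Γ : Type*} [Group Γ] {Sp : Type*} [NormedAddCommGroup Sp] [InnerProductSpace ℂ Sp]
  (ω : Γ →* (Sp ≃ₗᵢ[ℂ] Sp)) (V : Submodule ℂ Sp) (hV : ∀ (g : Γ) (v : Sp), v ∈ V → ω g v ∈ V)

/-- (Ported verbatim from the HodgeCMPerL package; no docstring in the source.) -/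
theorem rep_inv_apply_apply (g : Γ) (v : Sp) : ω g⁻¹ (ω g v) = v := by
  rw [← Function.comp_apply (f := ω g⁻¹), ← LinearIsometryEquiv.coe_mul, ← map_mul, inv_mul_cancel, map_one,
    LinearIsometryEquiv.coe_one, id_eq]

/-- (Ported verbatim from the HodgeCMPerL package; no docstring in the source.) -/
theorem rep_apply_inv_apply (g : Γ) (v : Sp) : ω g (ω g⁻¹ v) = v := by
  rw [← Function.comp_apply (f := ω g), ← LinearIsometryEquiv.coe_mul, ← map_mul, mul_inv_cancel, map_one,
    LinearIsometryEquiv.coe_one, id_eq]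

/-- `ω g` restricted to the `ω`-stable submodule `V`, as a linear isometry equivalence of `V`. -/
def restrictEquiv (g : Γ) : V ≃ₗᵢ[ℂ] V where
  toFun v := ⟨ω g v, hV g v v.2⟩
  map_add' v w := Subtype.ext (by simp)
  map_smul' c v := Subtype.ext (by simp)
  invFun v := ⟨ω g⁻¹ v, hV g⁻¹ v v.2⟩
  left_inv v := Subtype.ext (rep_inv_apply_apply ω g v)
  right_inv v := Subtype.ext (rep_apply_inv_apply ω g v)
  norm_map' v := (ω g).norm_map (v : Sp)

/-- (Ported verbatim from the HodgeCMPerL package; no docstring in the source.) -/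
@[simp] theorem coe_restrictEquiv_apply (g : Γ) (v : V) : ((restrictEquiv ω V hV g v : V) : Sp) = ω g v := rfl

/-- **the restricted representation** `ω|_V : Γ →* (V ≃ₗᵢ[ℂ] V)` on a stable submodule. -/
def restrict : Γ →* (V ≃ₗᵢ[ℂ] V) where
  toFun := restrictEquiv ω V hV
  map_one' := LinearIsometryEquiv.ext fun v => Subtype.ext (by
    show ω 1 (v : Sp) = v
    rw [map_one, LinearIsometryEquiv.coe_one, id_eq])
  map_mul' g g' := LinearIsometryEquiv.ext fun v => Subtype.ext (by
    show ω (g * g') (v : Sp) = ω g (ω g' v)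
    rw [map_mul, LinearIsometryEquiv.coe_mul, Function.comp_apply])

/-- (Ported verbatim from the HodgeCMPerL package; no docstring in the source.) -/
@[simp] theorem coe_restrict_apply (g : Γ) (v : V) : ((restrict ω V hV g v : V) : Sp) = ω g v := rfl

/-- the inclusion of a stable submodule is equivariant (file #1's `hE` for `E := V.subtypeₗᵢ`). -/
theorem subtype_restrict (g : Γ) (v : V) : V.subtypeₗᵢ (restrict ω V hV g v) = ω g (V.subtypeₗᵢ v) := rfl

/-- the (algebraic) CYCLIC SUBSPACE of `φ`: finite linear combinations of the translates `ω g φ`. -/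
def cyclicSpan (φ : Sp) : Submodule ℂ Sp := Submodule.span ℂ (Set.range fun g : Γ => ω g φ)

/-- (Ported verbatim from the HodgeCMPerL package; no docstring in the source.) -/
theorem mem_cyclicSpan_self (φ : Sp) : φ ∈ cyclicSpan ω φ :=
  Submodule.subset_span ⟨1, by simp⟩

/-- the cyclic subspace is stable. -/
theorem cyclicSpan_stable (φ : Sp) : ∀ (g : Γ) (v : Sp), v ∈ cyclicSpan ω φ → ω g v ∈ cyclicSpan ω φ := by
  intro g v hv
  have hle : (cyclicSpan ω φ).map (ω g).toLinearEquiv.toLinearMap ≤ cyclicSpan ω φ := by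
    rw [cyclicSpan, Submodule.map_span]
    refine Submodule.span_mono ?_
    rintro _ ⟨_, ⟨g', rfl⟩, rfl⟩
    exact ⟨g * g', by simp [map_mul]⟩
  exact hle (Submodule.mem_map.mpr ⟨v, hv, rfl⟩)

end restrict

end Transfer

/-! ## §2  The coefficient-level input structure -/

/-- **The representation-theoretic input of Lemma 4.2(b) for `U(1)_{L/L⁺}` at COEFFICIENT LEVEL**: pv09-g5's
`GenuineThetaInput L S Sp ω φ χ` with the isometric intertwiners `VU_v` (split `v ∉ S`, on `1_{𝒪_v³}`) and `VS_v`
(split `v ∈ S`, on `a_v • 1_D`) replaced by what the END reads off them — the identities of matrix coefficients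
`⟪φ, ω(ι_v g) φ⟫ = ⟪1_{𝒪³}, ω^{dil}_{ν_v}(τ_v g) 1_{𝒪³}⟫` resp. `= c_v · ⟪1_D, ω^{dil}_{ν_v}(τ_v g) 1_D⟫` with `0 < c_v`
(tex ll. 610–613: the local factor IS this coefficient).  No map from a local `L²` space into `Sp` is posited, so `Sp`
may be a space of Schwartz–Bruhat functions. -/
structure GenuineCoeffInput (L : Type) [Field L] [NumberField L] [IsCMField L]
    [DecidableEq (Place (maximalRealSubfield L))]
    [∀ v : HeightOneSpectrum (𝓞 (maximalRealSubfield L)), MeasurableSpace (v.adicCompletion (maximalRealSubfield L))]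
    [∀ v : HeightOneSpectrum (𝓞 (maximalRealSubfield L)), BorelSpace (v.adicCompletion (maximalRealSubfield L))]
    (S : Finset (Place (maximalRealSubfield L)))
    (Sp : Type) [NormedAddCommGroup Sp] [InnerProductSpace ℂ Sp]
    (ω : Model L →* (Sp ≃ₗᵢ[ℂ] Sp)) (φ : Sp) (χ : Model L →* Circle) where
  -- the local unitary characters `ν_v` of `(L⁺_v)ˣ`, unramified off `S`
  ν : ∀ i : Place (maximalRealSubfield L),
    ((basePlaceOf L i).adicCompletion (maximalRealSubfield L))ˣ →* Circle
  hν : ∀ i, i ∉ S → IsSplitPlace L i → ∀ u : ((basePlaceOf L i).adicCompletion (maximalRealSubfield L))ˣ,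
    ‖(u : (basePlaceOf L i).adicCompletion (maximalRealSubfield L))‖ = 1 → ν i u = 1
  -- split `v ∉ S`: the local coefficient of `φ` IS the dilation coefficient of `1_{𝒪_v³}` along the base chart
  hcoeffU : ∀ i (_ : i ∉ S) (hs : IsSplitPlace L i), ∀ g : locTorus (maximalRealSubfield L) L i,
    localCoeff (genLevel L) ω φ i g
      = ⟪ballIndicator (Adic.muV (maximalRealSubfield L) (basePlaceOf L i)) 0 1,
          dilationRep (Adic.muV (maximalRealSubfield L) (basePlaceOf L i)) (ν i) (baseTriv L i hs g)
            (ballIndicator (Adic.muV (maximalRealSubfield L) (basePlaceOf L i)) 0 1)⟫_ℂ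
  -- split `v ∈ S`: the ball `D = closedBall x₀ r`, the constant `c_v > 0`, and the coefficient identity
  x₀ : ∀ i : Place (maximalRealSubfield L), Fin 3 → (basePlaceOf L i).adicCompletion (maximalRealSubfield L)
  r : Place (maximalRealSubfield L) → ℝ
  c : Place (maximalRealSubfield L) → ℝ
  hr : ∀ i ∈ S, IsSplitPlace L i → r i < ‖x₀ i‖
  hr0 : ∀ i ∈ S, IsSplitPlace L i → 0 < r i
  hc : ∀ i ∈ S, IsSplitPlace L i → 0 < c i
  hνS : ∀ i ∈ S, IsSplitPlace L i → ∀ y : ((basePlaceOf L i).adicCompletion (maximalRealSubfield L))ˣ,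
    (y : (basePlaceOf L i).adicCompletion (maximalRealSubfield L)) ∈ U1 (x₀ i) (r i) → ν i y = 1
  hχS : ∀ i (_ : i ∈ S) (hs : IsSplitPlace L i), ∀ g : locTorus (maximalRealSubfield L) L i,
    ((baseTriv L i hs g : ((basePlaceOf L i).adicCompletion (maximalRealSubfield L))ˣ) :
        (basePlaceOf L i).adicCompletion (maximalRealSubfield L)) ∈ U1 (x₀ i) (r i) →
      χ (RestrictedProduct.mulSingle (genLevel L) i g) = 1
  hcoeffS : ∀ i (_ : i ∈ S) (hs : IsSplitPlace L i), ∀ g : locTorus (maximalRealSubfield L) L i,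
    localCoeff (genLevel L) ω φ i g
      = (c i : ℂ) * ⟪ballIndicator (Adic.muV (maximalRealSubfield L) (basePlaceOf L i)) (x₀ i) (r i),
          dilationRep (Adic.muV (maximalRealSubfield L) (basePlaceOf L i)) (ν i) (baseTriv L i hs g)
            (ballIndicator (Adic.muV (maximalRealSubfield L) (basePlaceOf L i)) (x₀ i) (r i))⟫_ℂ
  -- non-split `v ∈ S` (every infinite place included): isotypy of `φ`
  hiso : ∀ i ∈ S, ¬IsSplitPlace L i → ∀ g : locTorus (maximalRealSubfield L) L i, ω (RestrictedProduct.mulSingle (genLevel L) i g) φ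
    = conj (((χ (RestrictedProduct.mulSingle (genLevel L) i g) : Circle) : ℂ)) • φ

section structures

variable {L : Type} [Field L] [NumberField L] [IsCMField L]
  [DecidableEq (Place (maximalRealSubfield L))]
  [∀ v : HeightOneSpectrum (𝓞 (maximalRealSubfield L)), MeasurableSpace (v.adicCompletion (maximalRealSubfield L))]
  [∀ v : HeightOneSpectrum (𝓞 (maximalRealSubfield L)), BorelSpace (v.adicCompletion (maximalRealSubfield L))]
  {S : Finset (Place (maximalRealSubfield L))}
  {Sp Sp₁ Sp₂ : Type} [NormedAddCommGroup Sp] [InnerProductSpace ℂ Sp] [NormedAddCommGroup Sp₁] [InnerProductSpace ℂ Sp₁]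
  [NormedAddCommGroup Sp₂] [InnerProductSpace ℂ Sp₂]
  {ω : Model L →* (Sp ≃ₗᵢ[ℂ] Sp)} {ω₁ : Model L →* (Sp₁ ≃ₗᵢ[ℂ] Sp₁)} {ω₂ : Model L →* (Sp₂ ≃ₗᵢ[ℂ] Sp₂)}
  {φ : Sp} {φ₁ : Sp₁} {χ : Model L →* Circle}

/-- **intertwiners ⟹ coefficients**: pv09-g5's input yields the coefficient-level input (tree
`coeff_eq_of_intertwiner`, `coeffS_of_intertwiner`, `normSq_pos_of_map_smul_eq`; `c_v := ‖a_v‖²`, positive as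
`‖φ‖ = 1`). -/
def GenuineThetaInput.toCoeffInput (X : GenuineThetaInput L S Sp ω φ χ) (hφ : ‖φ‖ = 1) :
    GenuineCoeffInput L S Sp ω φ χ where
  ν := X.ν
  hν := X.hν
  hcoeffU i hi hs g := coeff_eq_of_intertwiner (genLevel L) ω φ
    (Adic.muV (maximalRealSubfield L) (basePlaceOf L i)) (X.ν i) i (fun g => baseTriv L i hs g) (X.VU i hi hs) _
    (X.hVUψ i hi hs) (X.hVU i hi hs) g
  x₀ := X.x₀
  r := X.r
  c i := ‖X.a i‖ ^ 2
  hr := X.hr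
  hr0 := X.hr0
  hc i hi hs := normSq_pos_of_map_smul_eq (X.VS i hi hs) (X.hVSψ i hi hs) hφ
  hνS := X.hνS
  hχS := X.hχS
  hcoeffS i hi hs g := coeffS_of_intertwiner (genLevel L) ω φ
    (Adic.muV (maximalRealSubfield L) (basePlaceOf L i)) (X.ν i) i (fun g => baseTriv L i hs g) (X.x₀ i) (X.r i) (X.a i)
    (X.VS i hi hs) (X.hVSψ i hi hs) (X.hVS i hi hs) g
  hiso := X.hiso

/-! ## §3  Functoriality in both directions -/

namespace GenuineCoeffInput

/-- **push forward** along an isometric equivariant map: the input for `(ω₂, E φ₁)` from the input for `(ω₁, φ₁)`. -/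
def map (X : GenuineCoeffInput L S Sp₁ ω₁ φ₁ χ) (E : Sp₁ →ₗᵢ[ℂ] Sp₂)
    (hE : ∀ (g : Model L) (v : Sp₁), E (ω₁ g v) = ω₂ g (E v)) :
    GenuineCoeffInput L S Sp₂ ω₂ (E φ₁) χ where
  ν := X.ν
  hν := X.hν
  hcoeffU i hi hs g := by
    rw [Transfer.localCoeff_map (genLevel L) ω₁ ω₂ E hE]
    exact X.hcoeffU i hi hs g
  x₀ := X.x₀
  r := X.r
  c := X.c
  hr := X.hr
  hr0 := X.hr0
  hc := X.hc
  hνS := X.hνS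
  hχS := X.hχS
  hcoeffS i hi hs g := by
    rw [Transfer.localCoeff_map (genLevel L) ω₁ ω₂ E hE]
    exact X.hcoeffS i hi hs g
  hiso i hi hs g := Transfer.map_smul_eq ω₁ ω₂ E hE (X.hiso i hi hs g)

/-- **pull back** along an isometric equivariant map: the input for `(ω₁, φ₁)` from the input for `(ω₂, E φ₁)`
(coefficients are invariants; isotypy by injectivity of `E`). -/
def comap (E : Sp₁ →ₗᵢ[ℂ] Sp₂) (hE : ∀ (g : Model L) (v : Sp₁), E (ω₁ g v) = ω₂ g (E v))
    (X : GenuineCoeffInput L S Sp₂ ω₂ (E φ₁) χ) : GenuineCoeffInput L S Sp₁ ω₁ φ₁ χ where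
  ν := X.ν
  hν := X.hν
  hcoeffU i hi hs g := by
    rw [← Transfer.localCoeff_map (genLevel L) ω₁ ω₂ E hE]
    exact X.hcoeffU i hi hs g
  x₀ := X.x₀
  r := X.r
  c := X.c
  hr := X.hr
  hr0 := X.hr0
  hc := X.hc
  hνS := X.hνS
  hχS := X.hχS
  hcoeffS i hi hs g := by
    rw [← Transfer.localCoeff_map (genLevel L) ω₁ ω₂ E hE]
    exact X.hcoeffS i hi hs g
  hiso i hi hs g := Transfer.smul_eq_of_map ω₁ ω₂ E hE (X.hiso i hi hs g)

end GenuineCoeffInput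

end structures

/-! ## §4  The END from the coefficient-level input, and along an embedding -/

section ofCoeffInput

variable (L : Type) [Field L] [NumberField L] [IsCMField L]

variable [DecidableEq (Place (maximalRealSubfield L))]
  [∀ v : HeightOneSpectrum (𝓞 (maximalRealSubfield L)), MeasurableSpace (v.adicCompletion (maximalRealSubfield L))]
  [∀ v : HeightOneSpectrum (𝓞 (maximalRealSubfield L)), BorelSpace (v.adicCompletion (maximalRealSubfield L))]
  (S₀ : Finset (Place (maximalRealSubfield L)))
  {Sp : Type} [NormedAddCommGroup Sp] [InnerProductSpace ℂ Sp]
  {W : Type} [AddCommGroup W] [Module L W]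
  {H Sbox : Type} [Group H] [AddCommGroup Sbox] [Module ℂ Sbox]
  {h : W →ₗ⋆[L] W →ₗ[L] L} (hW : IsLine L W) (hh : Anisotropic h)
  (D : DoublingDatum (Model L) H Sp Sbox) (GU : ThetaSide Sp Sbox)
  (j : isomBox h →* H) (hj : ∀ d : unitary L, j ⟨iotaSnd d, iotaSnd_mem h d⟩ = D.ι (1, unitaryToModel L d))
  (χ : Model L →* Circle) (hχΓ : ∀ d : unitary L, χ (unitaryToModel L d) = 1)
  (hχVΓ : ∀ d : unitary L, D.χV (unitaryToModel L d) = 1)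
  {hP : ∀ Ψ : Sbox, ∀ p ∈ (stabDelta L W).subgroupOf (isomBox h), ∀ x : H,
    D.fSW Ψ (j p * x) = D.fSW Ψ x}
  (P : GluePrintInputs D GU h j hP)
  (hloc : ∀ (i : Place (maximalRealSubfield L)) (v : Sp),
    Continuous fun g : locTorus (maximalRealSubfield L) L i => D.ω (RestrictedProduct.mulSingle (genLevel L) i g) v)
  {T' : Finset (Place (maximalRealSubfield L))} (hχT' : RestrictedProduct.boxSubgroup (genLevel L) T' ≤ χ.ker)
  (hlocχ : ∀ i ∈ T', Continuous fun g : locTorus (maximalRealSubfield L) L i => χ (RestrictedProduct.mulSingle (genLevel L) i g))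

section direct

variable (φ : Sp) (hφ : ‖φ‖ = 1)
  {T : Finset (Place (maximalRealSubfield L))} (hK : ∀ k ∈ RestrictedProduct.boxSubgroup (genLevel L) T, D.ω k φ = φ)
  (hM : ∀ S : Finset (Place (maximalRealSubfield L)), T ⊆ S → ∀ y : (i : ↥S) → locTorus (maximalRealSubfield L) L i,
    inner ℂ φ (D.ω (extendOne (genLevel L) S y) φ) = ∏ i : ↥S, localCoeff (genLevel L) D.ω φ i (y i))
  {S : Finset (Place (maximalRealSubfield L))} (hTS : T ⊆ S) (hT'S : T' ⊆ S)
  (hS : ∀ v : InfinitePlace (maximalRealSubfield L), Sum.inl v ∈ S)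
  (X : GenuineCoeffInput L S Sp D.ω φ χ)

include hW hh hj hχΓ hχVΓ P hφ hloc hK hM hTS hT'S hS X


-- port_pkg: scope closed for this part
end direct
end ofCoeffInput
end HodgeCM.PerL34.PureTensor
end
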